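import Summits.Langlands.Langlands.Theses.SenNullAlignment
import Summits.Langlands.Langlands.Theorems.IrreducibilityBySelfDualityReciprocityUpToIrreducibilityCorrespondsConj

/-!
# `Langlands → AwayFromEll` (refuter crux-attack evidence, crux stmt-Langlands-16361)

The S → C direction of the restates-the-summit probe, kernel-checked: the crux
`SenNullAlignment.AwayFromEll` (local–global compatibility at `v ∤ ℓ` for partial weight one Hilbert
forms, for EVERY reciprocity datum serving the regular case and EVERY irreducible `ρ` Satake–Frobenius
compatible with `π` a.e.) is a CONSEQUENCE of the summit statement `Langlands` — the universally
quantified `ρ` is handled by the tree's proved weak-to-strong upgrade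
`corresponds_of_exists_corresponds` (Chebotarev + Brauer–Nesbitt + change of frame).  Hence any
refutation `¬ AwayFromEll` would refute the summit statement itself: the crux cannot be
`refuted-substantive` unless `Langlands` (as typed) is false.  The converse `AwayFromEll → Langlands`
fails for `exact? | aesop | simp_all` (probe `probes/P_CtoS.lean`): the crux is not a costume of the
summit.  Evidence only (positive implication; not a Theorems landing).
-/

open Summit.Langlands.Langlands.Theses.SenNullAlignment
open Summit.Langlands.Langlands.Theorems.ReciprocityUpToIrreducibility

/-- The summit implies the crux `AwayFromEll` (S → C). [folklore] -/
theorem AwayFromEll_of_langlands (hS : _root_.Langlands) : AwayFromEll := by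
  intro K _ _ _hK RD _hreg hcpt π _k _w hL _hhol _hodd _hne ℓ _ ι ρ hirr hae v _hv
  obtain ⟨ρ₀, -, -, hcorr₀, -⟩ := ((hS K).2 RD 2 (by norm_num) hcpt).1 π hL ℓ ι
  exact (corresponds_of_exists_corresponds hirr hae ⟨ρ₀, hcorr₀⟩).2 v

#print axioms AwayFromEll_of_langlands
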